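import Mathlib
import Literature.MathematicalPhysics.QuantumFieldTheory.Balaban1983to89.B7BlockGeometry
import Literature.MathematicalPhysics.QuantumFieldTheory.Balaban1983to89.B9B8AveragingKernelZd
import HarnessLib

/-!
# Route `UnitScaleTilt`, crux K1 «MinimiserStabilityRegPr» (stmt-QuantumFields-19200) — route-R E′ (A′), LANE II «DIVERGENCE RECOVERY AT CURVED `W`» (★★OWNER RULING №23),
# brick (B2a-F5a) «THE TENT PROFILE ON THE ℓ-BOX», FILE 1∕2 (generic `ℤᵈ`): **the inline profile `β_ℓ(z) := (ℓ^d∕S_ℓ^d)·Π_i b_ℓ(z_i)`, `b_ℓ(t) := min (t mod ℓ) (ℓ − 1 − t mod ℓ)`,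
# `S_ℓ := Σ_{s<ℓ} min s (ℓ−1−s)`, is `N`-periodic for `ℓ ∣ N`, nonnegative, `≤ (9∕2)^d`, `2(9∕2)^d·ℓ⁻¹`-Lipschitz on bonds inside an `ℓ`-block, ZERO at both ends of every
# block-crossing bond, and normalised: `Σ_{x ∈ blockIter L k y} ((L^d)⁻¹)^k·β_{L^k}(x) = 1`** (odd `ℓ ≥ 3`; pure floor-division ∕ `Finset` algebra; ★p1 g19 LANE II NAMER WORD №7 (4),
# 2026-08-29).  FILE 2∕2 `UnitScaleTiltProp7TentProfileBox` reads these rows in the member letters of ✓p704472 ∕ ✓p705193 (`hβ hB hβlip hβ0 hβ1`).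

Cell `ym3-torus` ∕ width seat `ym3-torus-px9` (gen 7, «width 9»).  THEOREMS ONLY (0 `def`, 0 `sorry`; the profile is written INLINE); `--supports stmt-QuantumFields-19200 --as helper`,
count-neutral.  YM₃ on T³ is a ladder rung (R3), not d = 4, not the Clay problem; nothing here claims (B2a), the divergence-recovery row (REC), `hN06`, E′, EX or the gap.

WHY.  The smooth exact right inverse `J := I_σ + J⁰_σ ∘ N ∘ (1 − Q′∘I_σ)` of the comb average (brick (B2a)) uses a block-bump section `J⁰_σ u (x) = β(x)·Ad(σ_x)⁻¹ u(y(x))`; its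
gradient row (✓p705193 `norm_sq_DL2_section_le`) needs `|β| ≤ B`, in-block increments `≤ B′η` and `β = 0` at block-crossing bonds (the bump never differentiates across a block
face), and exactness at the hierarchical frame (✓p704472 `exists_exact_bumpSection_compT`) needs `Σ_{box}((L^d)⁻¹)^k β = 1`.  The separable tent does all of it with absolute
numerals (`S_ℓ ≥ ℓ²∕9` and `b_ℓ ≤ ℓ∕2` give the ratio `ℓ²∕(2S_ℓ) ≤ 9∕2`).

WHAT IS PROVED (ns `…Theorems.Prop7TentProfileZd`):
* §1 (the 1D tent on `ℤ`): `tent_nonneg`, `two_mul_tent_le`, `tent_le_half`, `tent_add_mul` (period `ℓ`), `emod_succ_of_ediv_succ_eq` ∕ `emod_of_ediv_succ_ne` (the in-block ∕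
  block-crossing dichotomy of a bond `(t, t+1)` under `⌊·∕ℓ⌋`), `tent_eq_zero_of_ediv_succ_ne` (both ends vanish at a crossing), ★ `abs_tent_succ_sub_le` (`|Δb| ≤ 1` in-block),
  `sum_tent_window` (every window sum is `S_ℓ`), `half_sq_le_sum_tent`, ★ `sq_div_nine_le_sum_tent` (`S_ℓ ≥ ℓ²∕9`, odd `ℓ ≥ 3`), `sum_tent_pos`.
* §2 (the product profile on `Fin d → ℤ`): ★ `profile_add_period` (i), `profile_nonneg`, `sq_div_two_sum_le`, `prod_tent_le`, ★ `profile_le` ∕ `abs_profile_le` (ii: `≤ (9∕2)^d`),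
  `blockMap_add_e_eq_iff`, ★ `profile_eq_zero_of_blockMap_ne` (iv), ★★ `abs_profile_succ_sub_le` (iii: `≤ 2(9∕2)^d·ℓ⁻¹`), `blockBase_add_cast_injective`, ★★ `sum_blockSites_profile`
  (`Σ_{B_ℓ(y)} β_ℓ = ℓ^d`), `iterate_blockMap_eq_blockMap_pow`, `blockIter_eq_blockSites_pow` (`blockIter L k y = blockSites (L^k) y`), ★★ `sum_blockIter_weight_mul_profile` (v).
HONEST SCOPE.  Integer floor-division and `Finset` algebra; nothing of the lattice gauge theory, of print, of (B2a) ∕ (REC) ∕ `hN06` ∕ the crux is asserted; rung R3, not Clay; YM gap NOT proved.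

References: T. Bałaban, CMP 99 (1985) 389–434 [Balaban1985BackgroundPropagators] ((3.17)–(3.19) p.393: block averages and their sections); T. Bałaban, CMP 98 (1985) 17–51
[Balaban1985Averaging] ((52)–(53) p.27, (78)–(80) p.30: the `L^k`-boxes); [folklore] (floor division on `ℤ`, tents).
-/

set_option autoImplicit false

namespace Summit.QuantumFields.YangMills.Theorems.Prop7TentProfileZd

open Literature.MathematicalPhysics.QuantumFieldTheory.Balaban1983to89
open Literature.MathematicalPhysics.QuantumLattice (blockMap blockBase blockSites mem_blockSites_iff)
open B7Prop1Explicit renaming Site → LSite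
open B7Prop1Explicit (e e_apply)
open B7BlockGeometry (blockMap_blockMap)
open B9B8AveragingKernelZd (blockIter mem_blockIter_iff)

/-! ## §1 The one-dimensional tent `b_ℓ(t) := min (t mod ℓ) (ℓ − 1 − t mod ℓ)` on `ℤ` -/

section OneDim

/-- `0 ≤ b_ℓ(t)` (`0 ≤ t mod ℓ ≤ ℓ − 1`). -/
theorem tent_nonneg {ℓ : ℕ} (hℓ : 0 < ℓ) (t : ℤ) :
    (0 : ℝ) ≤ ((min (t % (ℓ : ℤ)) ((ℓ : ℤ) - 1 - t % (ℓ : ℤ)) : ℤ) : ℝ) := by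
  have hℓz : (0 : ℤ) < ℓ := by exact_mod_cast hℓ
  have h0 := Int.emod_nonneg t hℓz.ne'
  have h1 := Int.emod_lt_of_pos t hℓz
  have h : (0 : ℤ) ≤ min (t % (ℓ : ℤ)) ((ℓ : ℤ) - 1 - t % (ℓ : ℤ)) := le_min h0 (by omega)
  exact_mod_cast h

/-- `2·b_ℓ(t) ≤ ℓ − 1` (the minimum of two numbers with sum `ℓ − 1`). -/
theorem two_mul_tent_le (ℓ : ℕ) (t : ℤ) :
    2 * ((min (t % (ℓ : ℤ)) ((ℓ : ℤ) - 1 - t % (ℓ : ℤ)) : ℤ) : ℝ) ≤ (ℓ : ℝ) - 1 := by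
  have h : 2 * (min (t % (ℓ : ℤ)) ((ℓ : ℤ) - 1 - t % (ℓ : ℤ))) ≤ (ℓ : ℤ) - 1 := by
    have h1 := min_le_left (t % (ℓ : ℤ)) ((ℓ : ℤ) - 1 - t % (ℓ : ℤ))
    have h2 := min_le_right (t % (ℓ : ℤ)) ((ℓ : ℤ) - 1 - t % (ℓ : ℤ))
    omega
  have h' : ((2 * (min (t % (ℓ : ℤ)) ((ℓ : ℤ) - 1 - t % (ℓ : ℤ))) : ℤ) : ℝ) ≤ (((ℓ : ℤ) - 1 : ℤ) : ℝ) := Int.cast_le.mpr h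
  simpa using h'

/-- `b_ℓ(t) ≤ ℓ ∕ 2`. -/
theorem tent_le_half (ℓ : ℕ) (t : ℤ) :
    ((min (t % (ℓ : ℤ)) ((ℓ : ℤ) - 1 - t % (ℓ : ℤ)) : ℤ) : ℝ) ≤ (ℓ : ℝ) / 2 := by
  have := two_mul_tent_le ℓ t
  linarith

/-- Periodicity: `b_ℓ(t + ℓ·c) = b_ℓ(t)`. -/
theorem tent_add_mul (ℓ : ℕ) (t c : ℤ) :
    ((min ((t + (ℓ : ℤ) * c) % (ℓ : ℤ)) ((ℓ : ℤ) - 1 - (t + (ℓ : ℤ) * c) % (ℓ : ℤ)) : ℤ) : ℝ)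
      = ((min (t % (ℓ : ℤ)) ((ℓ : ℤ) - 1 - t % (ℓ : ℤ)) : ℤ) : ℝ) := by
  rw [Int.add_mul_emod_self_left]

/-- In-box step: if `⌊(t+1)∕ℓ⌋ = ⌊t∕ℓ⌋` then `(t + 1) mod ℓ = t mod ℓ + 1`. -/
theorem emod_succ_of_ediv_succ_eq {ℓ : ℕ} (t : ℤ) (h : (t + 1) / (ℓ : ℤ) = t / (ℓ : ℤ)) :
    (t + 1) % (ℓ : ℤ) = t % (ℓ : ℤ) + 1 := by
  have h1 := Int.emod_add_mul_ediv t (ℓ : ℤ)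
  have h2 := Int.emod_add_mul_ediv (t + 1) (ℓ : ℤ)
  rw [h] at h2
  omega

/-- Box-crossing step: if `⌊(t+1)∕ℓ⌋ ≠ ⌊t∕ℓ⌋` (`ℓ ≥ 1`) then `t mod ℓ = ℓ − 1` and `(t + 1) mod ℓ = 0`. -/
theorem emod_of_ediv_succ_ne {ℓ : ℕ} (hℓ : 0 < ℓ) (t : ℤ) (h : (t + 1) / (ℓ : ℤ) ≠ t / (ℓ : ℤ)) :
    t % (ℓ : ℤ) = (ℓ : ℤ) - 1 ∧ (t + 1) % (ℓ : ℤ) = 0 := by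
  have hℓz : (0 : ℤ) < ℓ := by exact_mod_cast hℓ
  have h0 := Int.emod_nonneg t hℓz.ne'
  have h1 := Int.emod_lt_of_pos t hℓz
  have h2 := Int.emod_add_mul_ediv t (ℓ : ℤ)
  have key : t % (ℓ : ℤ) = (ℓ : ℤ) - 1 := by
    by_contra hne
    have hlt : t % (ℓ : ℤ) + 1 < (ℓ : ℤ) := by omega
    have huniq := (Int.ediv_emod_unique hℓz (a := t + 1) (q := t / (ℓ : ℤ)) (r := t % (ℓ : ℤ) + 1)).mpr
      ⟨by linarith, by omega, hlt⟩
    exact h huniq.1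
  refine ⟨key, ?_⟩
  have huniq := (Int.ediv_emod_unique hℓz (a := t + 1) (q := t / (ℓ : ℤ) + 1) (r := 0)).mpr
    ⟨by rw [key] at h2; linarith, le_refl _, hℓz⟩
  exact huniq.2

/-- At a box-crossing bond both tent values vanish: `t mod ℓ = ℓ − 1 ⇒ b_ℓ(t) = 0`, `(t+1) mod ℓ = 0 ⇒ b_ℓ(t+1) = 0`. -/
theorem tent_eq_zero_of_ediv_succ_ne {ℓ : ℕ} (hℓ : 0 < ℓ) (t : ℤ) (h : (t + 1) / (ℓ : ℤ) ≠ t / (ℓ : ℤ)) :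
    ((min (t % (ℓ : ℤ)) ((ℓ : ℤ) - 1 - t % (ℓ : ℤ)) : ℤ) : ℝ) = 0 ∧
      ((min ((t + 1) % (ℓ : ℤ)) ((ℓ : ℤ) - 1 - (t + 1) % (ℓ : ℤ)) : ℤ) : ℝ) = 0 := by
  obtain ⟨h1, h2⟩ := emod_of_ediv_succ_ne hℓ t h
  have hℓ1' : (1 : ℤ) ≤ ℓ := by exact_mod_cast hℓ
  have hℓ1 : (0 : ℤ) ≤ (ℓ : ℤ) - 1 := by linarith
  rw [h1, h2, sub_self, min_eq_right hℓ1, sub_zero, min_eq_left hℓ1]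
  simp

/-- In-box Lipschitz: `⌊(t+1)∕ℓ⌋ = ⌊t∕ℓ⌋ ⇒ |b_ℓ(t+1) − b_ℓ(t)| ≤ 1`. -/
theorem abs_tent_succ_sub_le {ℓ : ℕ} (t : ℤ) (h : (t + 1) / (ℓ : ℤ) = t / (ℓ : ℤ)) :
    |((min ((t + 1) % (ℓ : ℤ)) ((ℓ : ℤ) - 1 - (t + 1) % (ℓ : ℤ)) : ℤ) : ℝ)
        - ((min (t % (ℓ : ℤ)) ((ℓ : ℤ) - 1 - t % (ℓ : ℤ)) : ℤ) : ℝ)| ≤ 1 := by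
  rw [emod_succ_of_ediv_succ_eq t h]
  have key : |min (t % (ℓ : ℤ) + 1) ((ℓ : ℤ) - 1 - (t % (ℓ : ℤ) + 1)) - min (t % (ℓ : ℤ)) ((ℓ : ℤ) - 1 - t % (ℓ : ℤ))| ≤ 1 := by
    refine (abs_min_sub_min_le_max _ _ _ _).trans ?_
    apply max_le
    · simp
    · rw [show (ℓ : ℤ) - 1 - (t % (ℓ : ℤ) + 1) - ((ℓ : ℤ) - 1 - t % (ℓ : ℤ)) = -1 by ring]
      simp
  have hc : ((|min (t % (ℓ : ℤ) + 1) ((ℓ : ℤ) - 1 - (t % (ℓ : ℤ) + 1)) - min (t % (ℓ : ℤ)) ((ℓ : ℤ) - 1 - t % (ℓ : ℤ))| : ℤ) : ℝ)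
      ≤ ((1 : ℤ) : ℝ) := Int.cast_le.mpr key
  simpa only [Int.cast_abs, Int.cast_sub, Int.cast_one] using hc

/-- Window sum: on the `ℓ` consecutive integers `ℓ·c + s`, `s < ℓ`, the tent takes the values `min s (ℓ − 1 − s)`; so every window sum is
`S_ℓ := Σ_{s<ℓ} min s (ℓ − 1 − s)`. -/
theorem sum_tent_window (ℓ : ℕ) (c : ℤ) :
    ∑ s ∈ Finset.range ℓ, ((min (((ℓ : ℤ) * c + (s : ℤ)) % (ℓ : ℤ)) ((ℓ : ℤ) - 1 - ((ℓ : ℤ) * c + (s : ℤ)) % (ℓ : ℤ)) : ℤ) : ℝ)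
      = ∑ s ∈ Finset.range ℓ, ((min (s : ℤ) ((ℓ : ℤ) - 1 - (s : ℤ)) : ℤ) : ℝ) := by
  refine Finset.sum_congr rfl fun s hs => ?_
  have hs' : (s : ℤ) < (ℓ : ℤ) := by exact_mod_cast Finset.mem_range.mp hs
  have hmod : ((ℓ : ℤ) * c + (s : ℤ)) % (ℓ : ℤ) = (s : ℤ) := by
    rw [add_comm, Int.add_mul_emod_self_left, Int.emod_eq_of_lt (by positivity) hs']
  rw [hmod]

/-- The window sum dominates the increasing half of the tent: `S_ℓ ≥ m(m+1)∕2`, `m = ⌊(ℓ−1)∕2⌋`. -/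
theorem half_sq_le_sum_tent (ℓ : ℕ) :
    (((ℓ - 1) / 2 : ℕ) : ℝ) * ((((ℓ - 1) / 2 : ℕ) : ℝ) + 1) / 2
      ≤ ∑ s ∈ Finset.range ℓ, ((min (s : ℤ) ((ℓ : ℤ) - 1 - (s : ℤ)) : ℤ) : ℝ) := by
  set m : ℕ := (ℓ - 1) / 2 with hm
  rcases Nat.eq_zero_or_pos ℓ with hℓ0 | hℓpos
  · subst hℓ0
    simp [hm]
  have hmℓ : m + 1 ≤ ℓ := by omega
  have h2m : 2 * m ≤ ℓ - 1 := by omega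
  -- Gauss
  have hg := Finset.sum_range_id_mul_two (m + 1)
  rw [Nat.add_sub_cancel] at hg
  have hgR : (∑ s ∈ Finset.range (m + 1), ((s : ℤ) : ℝ)) * 2 = ((m : ℝ) + 1) * m := by
    have h' := congrArg (fun n : ℕ => (n : ℝ)) hg
    push_cast at h'
    have hcast : ∑ s ∈ Finset.range (m + 1), ((s : ℤ) : ℝ) = ∑ s ∈ Finset.range (m + 1), (s : ℝ) :=
      Finset.sum_congr rfl fun s _ => by norm_cast
    rw [hcast]
    exact h'
  calc (m : ℝ) * ((m : ℝ) + 1) / 2 = ∑ s ∈ Finset.range (m + 1), ((s : ℤ) : ℝ) := by linarith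
    _ = ∑ s ∈ Finset.range (m + 1), ((min (s : ℤ) ((ℓ : ℤ) - 1 - (s : ℤ)) : ℤ) : ℝ) := by
        refine Finset.sum_congr rfl fun s hs => ?_
        have hs' : s ≤ m := Nat.lt_succ_iff.mp (Finset.mem_range.mp hs)
        have hℓ1 : ((ℓ - 1 : ℕ) : ℤ) = (ℓ : ℤ) - 1 := by omega
        rw [min_eq_left (by omega)]
    _ ≤ ∑ s ∈ Finset.range ℓ, ((min (s : ℤ) ((ℓ : ℤ) - 1 - (s : ℤ)) : ℤ) : ℝ) := by
        apply Finset.sum_le_sum_of_subset_of_nonneg (Finset.range_mono hmℓ)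
        intro s hs _
        have hs' : s < ℓ := Finset.mem_range.mp hs
        have h : (0 : ℤ) ≤ min (s : ℤ) ((ℓ : ℤ) - 1 - (s : ℤ)) := le_min (by omega) (by omega)
        exact_mod_cast h

/-- For odd `ℓ ≥ 3`: `S_ℓ ≥ ℓ²∕9`. -/
theorem sq_div_nine_le_sum_tent {ℓ : ℕ} (hodd : Odd ℓ) (h3 : 3 ≤ ℓ) :
    (ℓ : ℝ) ^ 2 / 9 ≤ ∑ s ∈ Finset.range ℓ, ((min (s : ℤ) ((ℓ : ℤ) - 1 - (s : ℤ)) : ℤ) : ℝ) := by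
  have h := half_sq_le_sum_tent ℓ
  obtain ⟨m, rfl⟩ := hodd
  have hm : (2 * m + 1 - 1) / 2 = m := by omega
  rw [hm] at h
  have hm1 : (1 : ℝ) ≤ m := by exact_mod_cast (show 1 ≤ m by omega)
  push_cast at h ⊢
  nlinarith

/-- `S_ℓ > 0` for odd `ℓ ≥ 3`. -/
theorem sum_tent_pos {ℓ : ℕ} (hodd : Odd ℓ) (h3 : 3 ≤ ℓ) :
    0 < ∑ s ∈ Finset.range ℓ, ((min (s : ℤ) ((ℓ : ℤ) - 1 - (s : ℤ)) : ℤ) : ℝ) := by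
  have h := sq_div_nine_le_sum_tent hodd h3
  have : (0 : ℝ) < (ℓ : ℝ) ^ 2 / 9 := by
    have : (3 : ℝ) ≤ ℓ := by exact_mod_cast h3
    positivity
  linarith

end OneDim


/-! ## §2 The product profile `β_ℓ(z) := (ℓ^d ∕ S_ℓ^d)·Π_i b_ℓ(z_i)` on `ℤ^d`: rows (i)–(v) for generic `d` -/

section Product

variable {d : ℕ}

/-- (i) PERIODICITY: `β_ℓ(z + N•m) = β_ℓ(z)` whenever `ℓ ∣ N`. -/
theorem profile_add_period {ℓ N : ℕ} (hN : ℓ ∣ N) (z m : Fin d → ℤ) :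
    (((ℓ : ℝ) ^ d / (∑ s ∈ Finset.range ℓ, ((min (s : ℤ) ((ℓ : ℤ) - 1 - (s : ℤ)) : ℤ) : ℝ)) ^ d) * ∏ i : Fin d, ((min (((z + ((N : ℕ) : ℤ) • m) i) % (ℓ : ℤ)) ((ℓ : ℤ) - 1 - ((z + ((N : ℕ) : ℤ) • m) i) % (ℓ : ℤ)) : ℤ) : ℝ)) = (((ℓ : ℝ) ^ d / (∑ s ∈ Finset.range ℓ, ((min (s : ℤ) ((ℓ : ℤ) - 1 - (s : ℤ)) : ℤ) : ℝ)) ^ d) * ∏ i : Fin d, ((min ((z i) % (ℓ : ℤ)) ((ℓ : ℤ) - 1 - (z i) % (ℓ : ℤ)) : ℤ) : ℝ)) := by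
  obtain ⟨c, rfl⟩ := hN
  congr 1
  refine Finset.prod_congr rfl fun i _ => ?_
  have h : (z + (((ℓ * c : ℕ) : ℕ) : ℤ) • m) i = z i + (ℓ : ℤ) * ((c : ℤ) * m i) := by
    simp only [Pi.add_apply, Pi.smul_apply, smul_eq_mul, Nat.cast_mul]; ring
  rw [h]
  exact tent_add_mul ℓ (z i) ((c : ℤ) * m i)

/-- (ii) SIGN: `0 ≤ β_ℓ(z)` (`ℓ ≥ 1`). -/
theorem profile_nonneg {ℓ : ℕ} (hℓ : 0 < ℓ) (z : Fin d → ℤ) : 0 ≤ (((ℓ : ℝ) ^ d / (∑ s ∈ Finset.range ℓ, ((min (s : ℤ) ((ℓ : ℤ) - 1 - (s : ℤ)) : ℤ) : ℝ)) ^ d) * ∏ i : Fin d, ((min ((z i) % (ℓ : ℤ)) ((ℓ : ℤ) - 1 - (z i) % (ℓ : ℤ)) : ℤ) : ℝ)) := by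
  apply mul_nonneg
  · apply div_nonneg (by positivity)
    exact pow_nonneg (Finset.sum_nonneg fun s hs => by
      have hs' : s < ℓ := Finset.mem_range.mp hs
      have h : (0 : ℤ) ≤ min (s : ℤ) ((ℓ : ℤ) - 1 - (s : ℤ)) := le_min (by omega) (by omega)
      exact_mod_cast h) _
  · exact Finset.prod_nonneg fun i _ => tent_nonneg hℓ (z i)

/-- The key ratio: for odd `ℓ ≥ 3`, `ℓ²∕(2S_ℓ) ≤ 9∕2`. -/
theorem sq_div_two_sum_le {ℓ : ℕ} (hodd : Odd ℓ) (h3 : 3 ≤ ℓ) :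
    (ℓ : ℝ) ^ 2 / (2 * (∑ s ∈ Finset.range ℓ, ((min (s : ℤ) ((ℓ : ℤ) - 1 - (s : ℤ)) : ℤ) : ℝ))) ≤ 9 / 2 := by
  have hS := sq_div_nine_le_sum_tent hodd h3
  have hSpos := sum_tent_pos hodd h3
  rw [div_le_iff₀ (by positivity)]
  linarith

/-- The product of the tent factors over any finite set of coordinates is at most `(ℓ∕2)^{#s}`. -/
theorem prod_tent_le {ℓ : ℕ} (hℓ : 0 < ℓ) (z : Fin d → ℤ) (s : Finset (Fin d)) :
    ∏ i ∈ s, ((min ((z i) % (ℓ : ℤ)) ((ℓ : ℤ) - 1 - (z i) % (ℓ : ℤ)) : ℤ) : ℝ) ≤ ((ℓ : ℝ) / 2) ^ s.card := by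
  rw [← Finset.prod_const]
  exact Finset.prod_le_prod (fun i _ => tent_nonneg hℓ (z i)) fun i _ => tent_le_half ℓ (z i)

/-- (ii) SIZE: `β_ℓ(z) ≤ (9∕2)^d` for odd `ℓ ≥ 3` (`β ≤ (ℓ^d∕S^d)(ℓ∕2)^d = (ℓ²∕(2S))^d`). -/
theorem profile_le {ℓ : ℕ} (hodd : Odd ℓ) (h3 : 3 ≤ ℓ) (z : Fin d → ℤ) : (((ℓ : ℝ) ^ d / (∑ s ∈ Finset.range ℓ, ((min (s : ℤ) ((ℓ : ℤ) - 1 - (s : ℤ)) : ℤ) : ℝ)) ^ d) * ∏ i : Fin d, ((min ((z i) % (ℓ : ℤ)) ((ℓ : ℤ) - 1 - (z i) % (ℓ : ℤ)) : ℤ) : ℝ)) ≤ (9 / 2 : ℝ) ^ d := by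
  have hℓ : 0 < ℓ := by omega
  have hSpos := sum_tent_pos hodd h3
  have hprod := prod_tent_le hℓ z Finset.univ
  rw [Finset.card_univ, Fintype.card_fin] at hprod
  have hc : 0 ≤ (ℓ : ℝ) ^ d / (∑ s ∈ Finset.range ℓ, ((min (s : ℤ) ((ℓ : ℤ) - 1 - (s : ℤ)) : ℤ) : ℝ)) ^ d := by positivity
  calc (((ℓ : ℝ) ^ d / (∑ s ∈ Finset.range ℓ, ((min (s : ℤ) ((ℓ : ℤ) - 1 - (s : ℤ)) : ℤ) : ℝ)) ^ d) * ∏ i : Fin d, ((min ((z i) % (ℓ : ℤ)) ((ℓ : ℤ) - 1 - (z i) % (ℓ : ℤ)) : ℤ) : ℝ))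
      ≤ ((ℓ : ℝ) ^ d / (∑ s ∈ Finset.range ℓ, ((min (s : ℤ) ((ℓ : ℤ) - 1 - (s : ℤ)) : ℤ) : ℝ)) ^ d) * ((ℓ : ℝ) / 2) ^ d := mul_le_mul_of_nonneg_left hprod hc
    _ = ((ℓ : ℝ) ^ 2 / (2 * (∑ s ∈ Finset.range ℓ, ((min (s : ℤ) ((ℓ : ℤ) - 1 - (s : ℤ)) : ℤ) : ℝ)))) ^ d := by
        rw [show (ℓ : ℝ) ^ 2 / (2 * (∑ s ∈ Finset.range ℓ, ((min (s : ℤ) (((ℓ : ℕ) : ℤ) - 1 - (s : ℤ)) : ℤ) : ℝ))) = (ℓ : ℝ) / (∑ s ∈ Finset.range ℓ, ((min (s : ℤ) (((ℓ : ℕ) : ℤ) - 1 - (s : ℤ)) : ℤ) : ℝ)) * ((ℓ : ℝ) / 2) from by ring, mul_pow, div_pow, div_pow]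
    _ ≤ (9 / 2 : ℝ) ^ d := pow_le_pow_left₀ (by positivity) (sq_div_two_sum_le hodd h3) d

/-- (ii) SIZE, absolute-value form: `|β_ℓ(z)| ≤ (9∕2)^d`. -/
theorem abs_profile_le {ℓ : ℕ} (hodd : Odd ℓ) (h3 : 3 ≤ ℓ) (z : Fin d → ℤ) : |(((ℓ : ℝ) ^ d / (∑ s ∈ Finset.range ℓ, ((min (s : ℤ) ((ℓ : ℤ) - 1 - (s : ℤ)) : ℤ) : ℝ)) ^ d) * ∏ i : Fin d, ((min ((z i) % (ℓ : ℤ)) ((ℓ : ℤ) - 1 - (z i) % (ℓ : ℤ)) : ℤ) : ℝ))| ≤ (9 / 2 : ℝ) ^ d := by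
  rw [abs_of_nonneg (profile_nonneg (by omega) z)]
  exact profile_le hodd h3 z

/-- Block-map bookkeeping: the bond `(z, z + e_μ)` stays in its `ℓ`-block iff `⌊(z_μ + 1)∕ℓ⌋ = ⌊z_μ∕ℓ⌋`. -/
theorem blockMap_add_e_eq_iff (ℓ : ℕ) (z : Fin d → ℤ) (μ : Fin d) :
    blockMap ℓ (z + e μ) = blockMap ℓ z ↔ (z μ + 1) / (ℓ : ℤ) = z μ / (ℓ : ℤ) := by
  constructor
  · intro h
    have := congr_fun h μ
    simpa [blockMap, e_apply] using this
  · intro h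
    funext i
    by_cases hi : i = μ
    · subst hi; simpa [blockMap, e_apply] using h
    · simp [blockMap, e_apply, hi]

/-- (iv) BOUNDARY ZEROS: on a block-crossing bond both endpoint values of the profile vanish. -/
theorem profile_eq_zero_of_blockMap_ne {ℓ : ℕ} (hℓ : 0 < ℓ) (z : Fin d → ℤ) (μ : Fin d) (h : blockMap ℓ (z + e μ) ≠ blockMap ℓ z) :
    (((ℓ : ℝ) ^ d / (∑ s ∈ Finset.range ℓ, ((min (s : ℤ) ((ℓ : ℤ) - 1 - (s : ℤ)) : ℤ) : ℝ)) ^ d) * ∏ i : Fin d, ((min ((z i) % (ℓ : ℤ)) ((ℓ : ℤ) - 1 - (z i) % (ℓ : ℤ)) : ℤ) : ℝ)) = 0 ∧ (((ℓ : ℝ) ^ d / (∑ s ∈ Finset.range ℓ, ((min (s : ℤ) ((ℓ : ℤ) - 1 - (s : ℤ)) : ℤ) : ℝ)) ^ d) * ∏ i : Fin d, ((min (((z + e μ) i) % (ℓ : ℤ)) ((ℓ : ℤ) - 1 - ((z + e μ) i) % (ℓ : ℤ)) : ℤ) : ℝ)) = 0 := by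
  have h' : (z μ + 1) / (ℓ : ℤ) ≠ z μ / (ℓ : ℤ) := fun hh => h ((blockMap_add_e_eq_iff ℓ z μ).mpr hh)
  obtain ⟨h0, h1⟩ := tent_eq_zero_of_ediv_succ_ne hℓ (z μ) h'
  constructor
  · rw [Finset.prod_eq_zero (Finset.mem_univ μ) h0, mul_zero]
  · have hμ : (z + e μ) μ = z μ + 1 := by simp [e_apply]
    rw [Finset.prod_eq_zero (Finset.mem_univ μ) (by rw [hμ]; exact h1), mul_zero]

/-- (iii) IN-BLOCK INCREMENTS: `|β_ℓ(z + e_μ) − β_ℓ(z)| ≤ 2·(9∕2)^d·ℓ⁻¹` on bonds inside an `ℓ`-block (odd `ℓ ≥ 3`). -/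
theorem abs_profile_succ_sub_le {ℓ : ℕ} (hodd : Odd ℓ) (h3 : 3 ≤ ℓ) (z : Fin d → ℤ) (μ : Fin d) (h : blockMap ℓ (z + e μ) = blockMap ℓ z) :
    |(((ℓ : ℝ) ^ d / (∑ s ∈ Finset.range ℓ, ((min (s : ℤ) ((ℓ : ℤ) - 1 - (s : ℤ)) : ℤ) : ℝ)) ^ d) * ∏ i : Fin d, ((min (((z + e μ) i) % (ℓ : ℤ)) ((ℓ : ℤ) - 1 - ((z + e μ) i) % (ℓ : ℤ)) : ℤ) : ℝ)) - (((ℓ : ℝ) ^ d / (∑ s ∈ Finset.range ℓ, ((min (s : ℤ) ((ℓ : ℤ) - 1 - (s : ℤ)) : ℤ) : ℝ)) ^ d) * ∏ i : Fin d, ((min ((z i) % (ℓ : ℤ)) ((ℓ : ℤ) - 1 - (z i) % (ℓ : ℤ)) : ℤ) : ℝ))| ≤ 2 * (9 / 2 : ℝ) ^ d * (ℓ : ℝ)⁻¹ := by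
  have hℓ : 0 < ℓ := by omega
  have hℓR : (0 : ℝ) < ℓ := by exact_mod_cast hℓ
  have hSpos := sum_tent_pos hodd h3
  have h' : (z μ + 1) / (ℓ : ℤ) = z μ / (ℓ : ℤ) := (blockMap_add_e_eq_iff ℓ z μ).mp h
  have hd : 1 ≤ d := by
    rcases Nat.eq_zero_or_pos d with hd | hd
    · subst hd; exact (Fin.elim0 μ)
    · exact hd
  -- split both products at `μ`; off `μ` the two sites agree
  have hoff : ∀ i ∈ Finset.univ.erase μ, ((min (((z + e μ) i) % (ℓ : ℤ)) ((ℓ : ℤ) - 1 - ((z + e μ) i) % (ℓ : ℤ)) : ℤ) : ℝ) = ((min ((z i) % (ℓ : ℤ)) ((ℓ : ℤ) - 1 - (z i) % (ℓ : ℤ)) : ℤ) : ℝ) := by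
    intro i hi
    have hiμ : i ≠ μ := Finset.ne_of_mem_erase hi
    have : (z + e μ) i = z i := by simp [e_apply, hiμ]
    rw [this]
  have hμ : (z + e μ) μ = z μ + 1 := by simp [e_apply]
  rw [← mul_sub, ← Finset.mul_prod_erase Finset.univ _ (Finset.mem_univ μ), ← Finset.mul_prod_erase Finset.univ (fun i => ((min ((z i) % (ℓ : ℤ)) ((ℓ : ℤ) - 1 - (z i) % (ℓ : ℤ)) : ℤ) : ℝ)) (Finset.mem_univ μ),
    Finset.prod_congr rfl hoff, ← sub_mul, hμ]
  -- sizes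
  have hP := prod_tent_le hℓ z (Finset.univ.erase μ)
  rw [Finset.card_erase_of_mem (Finset.mem_univ μ), Finset.card_univ, Fintype.card_fin] at hP
  have hPnn : 0 ≤ ∏ i ∈ Finset.univ.erase μ, ((min ((z i) % (ℓ : ℤ)) ((ℓ : ℤ) - 1 - (z i) % (ℓ : ℤ)) : ℤ) : ℝ) := Finset.prod_nonneg fun i _ => tent_nonneg hℓ (z i)
  have hΔ := abs_tent_succ_sub_le (z μ) h'
  have hc : 0 ≤ (ℓ : ℝ) ^ d / (∑ s ∈ Finset.range ℓ, ((min (s : ℤ) ((ℓ : ℤ) - 1 - (s : ℤ)) : ℤ) : ℝ)) ^ d := by positivity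
  have hratio : ((ℓ : ℝ) ^ d / (∑ s ∈ Finset.range ℓ, ((min (s : ℤ) ((ℓ : ℤ) - 1 - (s : ℤ)) : ℤ) : ℝ)) ^ d) * ((ℓ : ℝ) / 2) ^ d ≤ (9 / 2 : ℝ) ^ d := by
    have := pow_le_pow_left₀ (by positivity : (0 : ℝ) ≤ (ℓ : ℝ) ^ 2 / (2 * (∑ s ∈ Finset.range ℓ, ((min (s : ℤ) ((ℓ : ℤ) - 1 - (s : ℤ)) : ℤ) : ℝ)))) (sq_div_two_sum_le hodd h3) d
    calc ((ℓ : ℝ) ^ d / (∑ s ∈ Finset.range ℓ, ((min (s : ℤ) ((ℓ : ℤ) - 1 - (s : ℤ)) : ℤ) : ℝ)) ^ d) * ((ℓ : ℝ) / 2) ^ d = ((ℓ : ℝ) ^ 2 / (2 * (∑ s ∈ Finset.range ℓ, ((min (s : ℤ) ((ℓ : ℤ) - 1 - (s : ℤ)) : ℤ) : ℝ)))) ^ d := by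
          rw [show (ℓ : ℝ) ^ 2 / (2 * (∑ s ∈ Finset.range ℓ, ((min (s : ℤ) (((ℓ : ℕ) : ℤ) - 1 - (s : ℤ)) : ℤ) : ℝ))) = (ℓ : ℝ) / (∑ s ∈ Finset.range ℓ, ((min (s : ℤ) (((ℓ : ℕ) : ℤ) - 1 - (s : ℤ)) : ℤ) : ℝ)) * ((ℓ : ℝ) / 2) from by ring, mul_pow, div_pow, div_pow]
      _ ≤ (9 / 2 : ℝ) ^ d := this
  rw [abs_mul, abs_mul, abs_of_nonneg hc, abs_of_nonneg hPnn]
  calc (ℓ : ℝ) ^ d / (∑ s ∈ Finset.range ℓ, ((min (s : ℤ) ((ℓ : ℤ) - 1 - (s : ℤ)) : ℤ) : ℝ)) ^ d * (|((min ((z μ + 1) % (ℓ : ℤ)) ((ℓ : ℤ) - 1 - (z μ + 1) % (ℓ : ℤ)) : ℤ) : ℝ) - ((min ((z μ) % (ℓ : ℤ)) ((ℓ : ℤ) - 1 - (z μ) % (ℓ : ℤ)) : ℤ) : ℝ)| * ∏ i ∈ Finset.univ.erase μ, ((min ((z i) % (ℓ : ℤ)) ((ℓ : ℤ) - 1 -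 (z i) % (ℓ : ℤ)) : ℤ) : ℝ))
      ≤ (ℓ : ℝ) ^ d / (∑ s ∈ Finset.range ℓ, ((min (s : ℤ) ((ℓ : ℤ) - 1 - (s : ℤ)) : ℤ) : ℝ)) ^ d * (1 * ((ℓ : ℝ) / 2) ^ (d - 1)) := by
        apply mul_le_mul_of_nonneg_left _ hc
        exact mul_le_mul hΔ hP hPnn zero_le_one
    _ = ((ℓ : ℝ) ^ d / (∑ s ∈ Finset.range ℓ, ((min (s : ℤ) ((ℓ : ℤ) - 1 - (s : ℤ)) : ℤ) : ℝ)) ^ d * ((ℓ : ℝ) / 2) ^ d) * (2 * (ℓ : ℝ)⁻¹) := by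
        have : ((ℓ : ℝ) / 2) ^ d = ((ℓ : ℝ) / 2) ^ (d - 1) * ((ℓ : ℝ) / 2) := by
          rw [← pow_succ, Nat.sub_add_cancel hd]
        rw [this]
        field_simp
    _ ≤ (9 / 2 : ℝ) ^ d * (2 * (ℓ : ℝ)⁻¹) := mul_le_mul_of_nonneg_right hratio (by positivity)
    _ = 2 * (9 / 2 : ℝ) ^ d * (ℓ : ℝ)⁻¹ := by ring

/-- The `ℓ`-block of `y` as an image of the offset cube (lit `blockSites`): injectivity of the offset chart. -/
theorem blockBase_add_cast_injective (ℓ : ℕ) (y : Fin d → ℤ) :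
    Function.Injective (fun t : Fin d → ℕ => blockBase ℓ y + fun i => (t i : ℤ)) := by
  intro t₁ t₂ h
  funext i
  have := congr_fun h i
  simp only [Pi.add_apply, add_right_inj] at this
  exact_mod_cast this

/-- (v) NORMALISATION over one `ℓ`-block: `Σ_{x ∈ B_ℓ(y)} β_ℓ(x) = ℓ^d` (the box is a product of windows; each window sum is `S_ℓ`). -/
theorem sum_blockSites_profile {ℓ : ℕ} (hodd : Odd ℓ) (h3 : 3 ≤ ℓ) (y : Fin d → ℤ) :
    ∑ x ∈ blockSites ℓ y, (((ℓ : ℝ) ^ d / (∑ s ∈ Finset.range ℓ, ((min (s : ℤ) ((ℓ : ℤ) - 1 - (s : ℤ)) : ℤ) : ℝ)) ^ d) * ∏ i : Fin d, ((min ((x i) % (ℓ : ℤ)) ((ℓ : ℤ) - 1 - (x i) % (ℓ : ℤ)) : ℤ) : ℝ)) = (ℓ : ℝ) ^ d := by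
  have hSpos := sum_tent_pos hodd h3
  rw [← Finset.mul_sum]
  have hbox : ∑ x ∈ blockSites ℓ y, ∏ i : Fin d, ((min ((x i) % (ℓ : ℤ)) ((ℓ : ℤ) - 1 - (x i) % (ℓ : ℤ)) : ℤ) : ℝ) = (∑ s ∈ Finset.range ℓ, ((min (s : ℤ) ((ℓ : ℤ) - 1 - (s : ℤ)) : ℤ) : ℝ)) ^ d := by
    rw [blockSites, Finset.sum_image fun t₁ _ t₂ _ h => blockBase_add_cast_injective ℓ y h]
    have hsummand : ∀ t : Fin d → ℕ, ∏ i : Fin d, ((min (((blockBase ℓ y + fun i => (t i : ℤ)) i) % (ℓ : ℤ)) ((ℓ : ℤ) - 1 - ((blockBase ℓ y + fun i => (t i : ℤ)) i) % (ℓ : ℤ)) : ℤ) : ℝ)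
        = ∏ i : Fin d, ((min (((ℓ : ℤ) * y i + ((t i : ℕ) : ℤ)) % (ℓ : ℤ)) ((ℓ : ℤ) - 1 - ((ℓ : ℤ) * y i + ((t i : ℕ) : ℤ)) % (ℓ : ℤ)) : ℤ) : ℝ) := by
      intro t
      refine Finset.prod_congr rfl fun i _ => ?_
      simp only [Pi.add_apply, blockBase]
    rw [Finset.sum_congr rfl fun t _ => hsummand t]
    rw [← Finset.prod_univ_sum (fun _ : Fin d => Finset.range ℓ) (fun i s => ((min (((ℓ : ℤ) * y i + ((s : ℕ) : ℤ)) % (ℓ : ℤ)) ((ℓ : ℤ) - 1 - ((ℓ : ℤ) * y i + ((s : ℕ) : ℤ)) % (ℓ : ℤ)) : ℤ) : ℝ))]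
    rw [Finset.prod_congr rfl fun i _ => sum_tent_window ℓ (y i), Finset.prod_const, Finset.card_univ, Fintype.card_fin]
  rw [hbox, div_mul_cancel₀ _ (pow_ne_zero _ hSpos.ne')]

/-- The iterated block map is the block map of the `L^k`-blocks (lit `blockMap_blockMap`, iterated). -/
theorem iterate_blockMap_eq_blockMap_pow (L k : ℕ) (x : Fin d → ℤ) : (blockMap L)^[k] x = blockMap (L ^ k) x := by
  induction k generalizing x with
  | zero => funext i; simp [blockMap]
  | succ k ih => rw [Function.iterate_succ_apply, ih, blockMap_blockMap, pow_succ']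

/-- The comb box `blockIter L k y` IS the `L^k`-block of `y`. -/
theorem blockIter_eq_blockSites_pow (L : ℕ) [NeZero L] (k : ℕ) (y : Fin d → ℤ) : blockIter L k y = blockSites (L ^ k) y := by
  ext x
  rw [mem_blockIter_iff, mem_blockSites_iff, iterate_blockMap_eq_blockMap_pow]

/-- (v) NORMALISATION in the comb-box letters of ✓`exists_exact_bumpSection_compT` (`hβ1`): `Σ_{x ∈ blockIter L k y} ((L^d)⁻¹)^k·β_{L^k}(x) = 1` (odd `L^k ≥ 3`). -/
theorem sum_blockIter_weight_mul_profile (L : ℕ) [NeZero L] (k : ℕ) (hodd : Odd (L ^ k)) (h3 : 3 ≤ L ^ k) (y : Fin d → ℤ) :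
    ∑ x ∈ blockIter L k y, ((((L : ℝ) ^ d)⁻¹) ^ k * ((((L ^ k : ℕ) : ℝ) ^ d / (∑ s ∈ Finset.range (L ^ k), ((min (s : ℤ) (((L ^ k : ℕ) : ℤ) - 1 - (s : ℤ)) : ℤ) : ℝ)) ^ d) * ∏ i : Fin d, ((min ((x i) % ((L ^ k : ℕ) : ℤ)) (((L ^ k : ℕ) : ℤ) - 1 - (x i) % ((L ^ k : ℕ) : ℤ)) : ℤ) : ℝ))) = 1 := by
  rw [← Finset.mul_sum, blockIter_eq_blockSites_pow, sum_blockSites_profile hodd h3 y]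
  have hL : (0 : ℝ) < L := by exact_mod_cast Nat.pos_of_ne_zero (NeZero.ne L)
  rw [Nat.cast_pow, inv_pow, ← pow_mul, ← pow_mul, Nat.mul_comm d k]
  exact inv_mul_cancel₀ (pow_ne_zero _ hL.ne')

end Product

end Summit.QuantumFields.YangMills.Theorems.Prop7TentProfileZd
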